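import Summits.CriticalPhenomena.PercolationContinuityZ3.Theorems.PercNearOneGluingNoHeavyPcintLoopExclusionRungFourDimension
import Summits.CriticalPhenomena.PercolationContinuityZ3.Theorems.PercNearOneGluingNoHeavyPcintLoopExclusionSiteRungFourDimension
import HarnessLib

/-!
# CriticalPhenomena/PercolationContinuityZ3 — Theorems/PercNearOneGluingNoHeavyPcintLoopExclusionRungFourCrossColumn.lean: the CROSS-COLUMN ORDER at the first rung — `R_4(d) < R^N_4(d)` for every `d ≥ 3`, reversed at `d = 2`; why the typed conjecture `siteLoopCompat_lt_loopCompat_conj` starts at `τ = 6`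

Lane prim-pcint, STRUCTURE rule (NULLS MINED FOR WHY).  Clause (e) of the typed site law (…PcintLoopExclusionSiteLaw)
conjectures `R^N_τ(d) < R_τ(d)` for `d ≥ 3` and even `τ = 2m ≥ 6` — "at `τ = 4` the order is REVERSED by a hair
(0.720 > 0.715, 0.797 > 0.780, 0.869 > 0.848), whence `m ≥ 3`".  With the closed forms of the first rung
(…RungFourCounts) and the two dimension laws (…RungFourDimension: `(2d−1)(1 − R_4) → 2`; …SiteRungFourDimension:
`(2d−1)(1 − R^N_4) → 3/2`) the hair is a THEOREM and has a mechanism: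

* **`loopCompat_four_lt_siteLoopCompat_four`: `R_4(d) < R^N_4(d)` for EVERY `d ≥ 3`** (`d ≥ 5`: the bond upper bound `A(x)`
  lies below the site lower bound `B^N(x)`, certificate `crossPoly_pos` on `x ≥ 9`; `d = 3, 4`: decimal brackets
  `μ_4(3) ≥ 4.8645`, `√5 ≤ 2.23607`, `μ_4(4) ≥ 6.8916`, `√10 ≤ 3.16228` with the third-order logarithmic series — the
  `d = 3` margin is `0.0044`);
* **`siteLoopCompat_four_two_lt_loopCompat_four_two`: `R^N_4(2) < R_4(2)`** (0.5499 < 0.5864; `√2 ≥ 1.41421`, `μ_4(2) ≤ 2.8312`);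
* **`not_siteLoopCompat_lt_loopCompat_rung_four`**: the `m = 2` extension of clause (e) is FALSE — the typed conjecture's
  restriction to `m ≥ 3` is forced, not cosmetic.

MECHANISM (IDENTIFIED): the first-rung defects are `1 − R_4(d) = 2/x + O(x⁻²)` and `1 − R^N_4(d) = 3/(2x) + O(x⁻²)`,
`x = 2d − 1`, so `R^N_4 − R_4 = 1/(2x) + O(x⁻²) > 0` for all large `d`, and the explicit brackets push "large" down to
`d = 3`; at `d = 2` the `O(x⁻²)` terms win (`x = 3`).  The site loops at `τ = 4` are the SAME unit squares as the bond loops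
(`closingNawCount_four_eq_closingCount_four`), but the site reference walk (memory-2 = non-reversing, `μ^N_2 = μ_2 = 2d−1`)
loses a full unit of growth at the next site rung (`μ^N_4 ≈ 2d − 2 + 1/(2d)`) against `1/(2d)` for the bond rung
(`μ_4 ≈ 2d − 1 − 1/(2d)`), while the lane's site density carries the factor `1 + μ^N_2 = 2d`: `Δ^N_4/f^N_4` ends up closer
to `1` by the factor `3/4` in the defect.  From `τ = 6` on the site loops (chordless hexagons avoiding adjacency with the
arms) are genuinely harder to fit than the bond hexagons and the measured order `R^N < R` sets in (conjecture (e)).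

HONEST FRAMING: elementary real analysis on closed forms; nothing here is used by a certified `p_c` cell.
Written by prim-pcint-2 gen 17 (prover-prim-pcint-2-g17-0), 2026-08-25.
-/

noncomputable section

open Filter Topology
open Literature.Probability.LatticeModels Literature.Probability.Percolation
open Summit.CriticalPhenomena.PercolationContinuityZ3.Theorems.Pcint
open Summit.CriticalPhenomena.PercolationContinuityZ3.Theorems.Pcint.MemoryTail

namespace Summit.CriticalPhenomena.PercolationContinuityZ3.Theorems.Pcint.NawTail

variable {d : ℕ}

/-- Certificate of the cross-column order for `x ≥ 9` (degree 11): `B^N_num·A_den − A_num·B^N_den > 0`. [folklore] -/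
theorem crossPoly_pos {x : ℝ} (hx : 9 ≤ x) : 0 < -54 + 180 * x - 150 * x ^ 2 - 144 * x ^ 3 + 330 * x ^ 4 - 152 * x ^ 5 - 60 * x ^ 6 + 56 * x ^ 7 - 35 * x ^ 8 + 57 * x ^ 9 - 31 * x ^ 10 + 3 * x ^ 11 := by
  obtain ⟨s, hs, rfl⟩ : ∃ s : ℝ, 0 ≤ s ∧ x = s + 9 := ⟨x - 9, by linarith, by ring⟩
  have e : -54 + 180 * (s + 9) - 150 * (s + 9) ^ 2 - 144 * (s + 9) ^ 3 + 330 * (s + 9) ^ 4 - 152 * (s + 9) ^ 5 - 60 * (s + 9) ^ 6 + 56 * (s + 9) ^ 7 - 35 * (s + 9) ^ 8 + 57 * (s + 9) ^ 9 - 31 * (s + 9) ^ 10 + 3 * (s + 9) ^ 11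
      = 6858228960 + 15890275836 * s + 13230630084 * s ^ 2 + 5956159059 * s ^ 3 + 1684823298 * s ^ 4 + 321070564 * s ^ 5 + 42544344 * s ^ 6 + 3947258 * s ^ 7 + 252442 * s ^ 8 + 10632 * s ^ 9 + 266 * s ^ 10 + 3 * s ^ 11 := by ring
  rw [e]; positivity

/-- `R_4(d) < R^N_4(d)` for `d ≥ 5`: the bond upper bound `A(x)` is below the site lower bound `B^N(x)` for `x ≥ 9`. [folklore] -/
theorem loopCompat_four_lt_siteLoopCompat_four_of_five_le (hd : 5 ≤ d) :
    MemoryTail.loopCompat d 4 < siteLoopCompat d 4 := by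
  have hd' : (5 : ℝ) ≤ d := by exact_mod_cast hd
  set x : ℝ := 2 * d - 1 with hx
  have hx9 : 9 ≤ x := by rw [hx]; linarith
  have hx0 : 0 < x := by linarith
  have hx1 : 0 < x - 1 := by linarith
  have hx21 : 0 < x ^ 2 - 1 := by nlinarith
  have hA := MemoryTail.loopCompat_four_le_rat (by omega) hx
  have hB := siteLoopCompat_four_ge_rat (by omega) hx
  have hDA : 0 < x ^ 4 * (x ^ 2 - 1) := mul_pos (pow_pos hx0 4) hx21
  have hDB : 0 < 6 * (x - 1) ^ 4 * (x + 1) ^ 2 := by positivity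
  have e : (-16 * x + 12 * x ^ 2 + 17 * x ^ 4 - 21 * x ^ 5 + 6 * x ^ 6) * (x ^ 4 * (x ^ 2 - 1)) - (9 - 12 * x + 10 * x ^ 2 - 4 * x ^ 3 + 4 * x ^ 4 - 2 * x ^ 5 + x ^ 6) * (6 * (x - 1) ^ 4 * (x + 1) ^ 2)
      = -54 + 180 * x - 150 * x ^ 2 - 144 * x ^ 3 + 330 * x ^ 4 - 152 * x ^ 5 - 60 * x ^ 6 + 56 * x ^ 7 - 35 * x ^ 8 + 57 * x ^ 9 - 31 * x ^ 10 + 3 * x ^ 11 := by ring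
  have hP := crossPoly_pos hx9
  have hlt : (9 - 12 * x + 10 * x ^ 2 - 4 * x ^ 3 + 4 * x ^ 4 - 2 * x ^ 5 + x ^ 6) / (x ^ 4 * (x ^ 2 - 1)) < (-16 * x + 12 * x ^ 2 + 17 * x ^ 4 - 21 * x ^ 5 + 6 * x ^ 6) / (6 * (x - 1) ^ 4 * (x + 1) ^ 2) := by
    rw [div_lt_div_iff₀ hDA hDB]
    linarith
  exact lt_of_le_of_lt hA (lt_of_lt_of_le hlt hB)

/-- A decimal upper bound for `R_4(d)`: if `θ ≤ μ_4(d)` with `θ ≤ 2d−1 ≤ 2θ` then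
`R_4(d) ≤ (2d−1)⁴/(2d(2d−2)) · (t + t²/2 + t³/3 + 2t⁴)`, `t = (2d−1−θ)/(2d−1)`. [folklore] -/
theorem loopCompat_four_le_of_le_memGrowth (hd : 2 ≤ d) {θ : ℝ} (hθ : 1 < θ)
    (hp : θ ^ 3 ≤ (2 * d - 2) * θ ^ 2 + (2 * d - 2) * θ + 1) (hθx : θ ≤ 2 * d - 1) (h2 : 2 * (d : ℝ) - 1 ≤ 2 * θ) :
    MemoryTail.loopCompat d 4 ≤ (2 * (d : ℝ) - 1) ^ 4 / (2 * d * (2 * d - 2)) *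
      ((2 * d - 1 - θ) / (2 * d - 1) + ((2 * d - 1 - θ) / (2 * d - 1)) ^ 2 / 2
        + ((2 * d - 1 - θ) / (2 * d - 1)) ^ 3 / 3 + 2 * ((2 * d - 1 - θ) / (2 * d - 1)) ^ 4) := by
  haveI : NeZero d := ⟨by omega⟩
  have hd' : (2 : ℝ) ≤ d := by exact_mod_cast hd
  have hx0 : (0 : ℝ) < 2 * d - 1 := by linarith
  have hθ0 : 0 < θ := by linarith
  have hμ := MemoryTail.le_memGrowth_four_of_cubic_nonpos hd hθ hp
  have hμpos : 0 < MemoryTail.memGrowth d 4 := MemoryTail.memGrowth_pos 4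
  have hlog : Real.log ((2 * (d : ℝ) - 1) / MemoryTail.memGrowth d 4) ≤ _ :=
    (Real.log_le_log (div_pos hx0 hμpos) (div_le_div_of_nonneg_left hx0.le hθ0 hμ)).trans
      (MemoryTail.log_div_le_series_four hθ0 hθx h2)
  rw [MemoryTail.loopCompat_four_eq hd]
  exact mul_le_mul_of_nonneg_left hlog (div_pos (pow_pos hx0 4) (mul_pos (by positivity) (by linarith))).le

/-- A decimal lower bound for `R^N_4(d)`: if `√((d−1)²+1) ≤ r` then with `λ' = (d−1) + r ≥ λ_d`,
`R^N_4(d) ≥ (2d−1)⁴/(8d²(d−1)) · (w + w²/2 + w³/3)`, `w = (2d−1−λ')/(2d−1)` (for `λ' ≤ 2d−1`). [folklore] -/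
theorem siteLoopCompat_four_ge_of_sqrt_le (hd : 2 ≤ d) {r : ℝ} (hr : Real.sqrt (((d : ℝ) - 1) ^ 2 + 1) ≤ r)
    (hrx : (d : ℝ) - 1 + r ≤ 2 * d - 1) :
    (2 * (d : ℝ) - 1) ^ 4 / (8 * d ^ 2 * (d - 1)) *
      ((2 * d - 1 - ((d : ℝ) - 1 + r)) / (2 * d - 1) + ((2 * d - 1 - ((d : ℝ) - 1 + r)) / (2 * d - 1)) ^ 2 / 2
        + ((2 * d - 1 - ((d : ℝ) - 1 + r)) / (2 * d - 1)) ^ 3 / 3) ≤ siteLoopCompat d 4 := by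
  have hd' : (2 : ℝ) ≤ d := by exact_mod_cast hd
  have hx0 : (0 : ℝ) < 2 * d - 1 := by linarith
  have hs0 : 0 < Real.sqrt (((d : ℝ) - 1) ^ 2 + 1) := Real.sqrt_pos.2 (by positivity)
  have hlam0 : 0 < (d : ℝ) - 1 + Real.sqrt (((d : ℝ) - 1) ^ 2 + 1) := by linarith
  have hlam'0 : 0 < (d : ℝ) - 1 + r := by linarith
  have hlog : _ ≤ Real.log ((2 * (d : ℝ) - 1) / ((d - 1 : ℝ) + Real.sqrt ((d - 1) ^ 2 + 1))) :=
    (MemoryTail.series_three_le_log_div hlam'0 hrx).trans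
      (Real.log_le_log (div_pos hx0 hlam'0) (div_le_div_of_nonneg_left hx0.le hlam0 (by linarith)))
  rw [siteLoopCompat_four_eq hd]
  exact mul_le_mul_of_nonneg_left hlog (div_pos (pow_pos hx0 4) (mul_pos (by positivity) (by linarith))).le

/-- **`R_4(3) < R^N_4(3)`** (0.7153 < 0.7196, margin 0.0044): `μ_4(3) ≥ 4.8645` and `√5 ≤ 2.23607`. [folklore] -/
theorem loopCompat_four_lt_siteLoopCompat_four_three : MemoryTail.loopCompat 3 4 < siteLoopCompat 3 4 := by
  have hA := loopCompat_four_le_of_le_memGrowth (d := 3) (by norm_num) (θ := 4.8645) (by norm_num) (by norm_num)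
    (by norm_num) (by norm_num)
  have hr : Real.sqrt ((((3 : ℕ) : ℝ) - 1) ^ 2 + 1) ≤ 2.23607 := by
    rw [Real.sqrt_le_left (by norm_num)]; norm_num
  have hB := siteLoopCompat_four_ge_of_sqrt_le (d := 3) (by norm_num) hr (by norm_num)
  norm_num at hA hB
  linarith

/-- **`R_4(4) < R^N_4(4)`** (0.7802 < 0.7970): `μ_4(4) ≥ 6.8916` and `√10 ≤ 3.16228`. [folklore] -/
theorem loopCompat_four_lt_siteLoopCompat_four_four : MemoryTail.loopCompat 4 4 < siteLoopCompat 4 4 := by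
  have hA := loopCompat_four_le_of_le_memGrowth (d := 4) (by norm_num) (θ := 6.8916) (by norm_num) (by norm_num)
    (by norm_num) (by norm_num)
  have hr : Real.sqrt ((((4 : ℕ) : ℝ) - 1) ^ 2 + 1) ≤ 3.16228 := by
    rw [Real.sqrt_le_left (by norm_num)]; norm_num
  have hB := siteLoopCompat_four_ge_of_sqrt_le (d := 4) (by norm_num) hr (by norm_num)
  norm_num at hA hB
  linarith

/-- **The first-rung cross-column order: `R_4(d) < R^N_4(d)` for every `d ≥ 3`** — the rung the typed conjecture
`siteLoopCompat_lt_loopCompat_conj` (`R^N_{2m} < R_{2m}`, `m ≥ 3`) leaves out carries the OPPOSITE order, in every dimension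
`d ≥ 3`. [folklore] -/
theorem loopCompat_four_lt_siteLoopCompat_four (hd : 3 ≤ d) : MemoryTail.loopCompat d 4 < siteLoopCompat d 4 := by
  rcases (show d = 3 ∨ d = 4 ∨ 5 ≤ d by omega) with rfl | rfl | h5
  · exact loopCompat_four_lt_siteLoopCompat_four_three
  · exact loopCompat_four_lt_siteLoopCompat_four_four
  · exact loopCompat_four_lt_siteLoopCompat_four_of_five_le h5

/-- **`R^N_4(2) < R_4(2)`** (0.5499 < 0.5864): at `d = 2` the order of clause (e) holds already at `τ = 4`
(`√2 ≥ 1.41421`, `μ_4(2) ≤ 2.8312`). [folklore] -/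
theorem siteLoopCompat_four_two_lt_loopCompat_four_two : siteLoopCompat 2 4 < MemoryTail.loopCompat 2 4 := by
  -- site upper bound at d = 2
  have hs : (1.41421 : ℝ) ≤ Real.sqrt 2 := by
    rw [Real.le_sqrt' (by norm_num)]; norm_num
  have hs2 : Real.sqrt 2 ≤ 1.5 := by
    rw [Real.sqrt_le_left (by norm_num)]; norm_num
  have hlam0 : (0 : ℝ) < 1 + Real.sqrt 2 := by linarith
  have hS := siteLoopCompat_four_eq (d := 2) le_rfl
  norm_num at hS
  have hupper : Real.log (3 / (1 + Real.sqrt 2)) ≤ (3 - 2.41421) / 3 + ((3 - 2.41421) / 3) ^ 2 / 2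
      + ((3 - 2.41421) / 3) ^ 3 / 3 + 2 * ((3 - 2.41421) / 3) ^ 4 := by
    have h1 : Real.log (3 / (1 + Real.sqrt 2)) ≤ Real.log (3 / 2.41421) :=
      Real.log_le_log (div_pos (by norm_num) hlam0) (div_le_div_of_nonneg_left (by norm_num) (by norm_num) (by linarith))
    have h2 := MemoryTail.log_div_le_series_four (x := 3) (θ := 2.41421) (by norm_num) (by norm_num) (by norm_num)
    linarith
  -- bond lower bound at d = 2
  have hμ : MemoryTail.memGrowth 2 4 ≤ 2.8312 :=
    MemoryTail.memGrowth_four_le_of_cubic_nonneg (d := 2) le_rfl (by norm_num) (by norm_num)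
  haveI : NeZero (2 : ℕ) := ⟨by norm_num⟩
  have hμpos : 0 < MemoryTail.memGrowth 2 4 := MemoryTail.memGrowth_pos 4
  have hR := MemoryTail.loopCompat_four_eq (d := 2) le_rfl
  norm_num at hR
  have hlower : (3 - 2.8312) / 3 + ((3 - 2.8312) / 3) ^ 2 / 2 + ((3 - 2.8312) / 3) ^ 3 / 3
      ≤ Real.log (3 / MemoryTail.memGrowth 2 4) := by
    have h1 := MemoryTail.series_three_le_log_div (x := 3) (θ := 2.8312) (by norm_num) (by norm_num)
    have h2 : Real.log (3 / 2.8312) ≤ Real.log (3 / MemoryTail.memGrowth 2 4) :=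
      Real.log_le_log (by norm_num) (div_le_div_of_nonneg_left (by norm_num) hμpos hμ)
    linarith
  have hnum : (81 : ℝ) / 32 * ((3 - 2.41421) / 3 + ((3 - 2.41421) / 3) ^ 2 / 2 + ((3 - 2.41421) / 3) ^ 3 / 3
      + 2 * ((3 - 2.41421) / 3) ^ 4)
      < 81 / 8 * ((3 - 2.8312) / 3 + ((3 - 2.8312) / 3) ^ 2 / 2 + ((3 - 2.8312) / 3) ^ 3 / 3) := by
    norm_num
  rw [hS, hR]
  nlinarith

/-- **The `m = 2` extension of clause (e) `siteLoopCompat_lt_loopCompat_conj` is FALSE**: it fails at every `d ≥ 3`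
(e.g. `d = 3`), which is why the typed conjecture starts at `m = 3` (`τ = 6`). [folklore] -/
theorem not_siteLoopCompat_lt_loopCompat_rung_four :
    ¬ ∀ d : ℕ, 3 ≤ d → siteLoopCompat d (2 * 2) < MemoryTail.loopCompat d (2 * 2) := by
  intro h
  have h3 := h 3 le_rfl
  have := loopCompat_four_lt_siteLoopCompat_four_three
  norm_num at h3
  linarith

end Summit.CriticalPhenomena.PercolationContinuityZ3.Theorems.Pcint.NawTail
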